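import Literature.NumberTheory.EllipticCurves.WeierstrassCurveCharts
import Mathlib.AlgebraicGeometry.Morphisms.Smooth
import Mathlib.AlgebraicGeometry.Morphisms.UniversallyOpen
import HarnessLib

/-!
# The square `E_W ×_K E_W`: integrality and its affine charts `Spec (A_a ⊗_K A_b)`

For a Weierstrass curve `W` over a field `K` and its plane cubic `E = E_W` (`WeierstrassCurve.scheme`,
a `K`-scheme; `E ⊗ E` is the fibre product over `Spec K` in Mathlib's cartesian monoidal structure
on `Over (Spec K)`):

* `isIntegral_tensor_left`: for `W` elliptic, `(Y ⊗ E).left = Y ×_K E` is integral whenever `Y` is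
  (`E → Spec K` is geometrically integral, flat and universally open, being smooth; Mathlib's
  `IsIntegral (pullback f g)` instance, Stacks 038F); in particular `E ×_K E` and `(E ×_K E) ×_K E`
  are integral (reduced, irreducible);
* `W.squareRing a b = A_a ⊗_K A_b` (`a b : ChartIdx`, the charts `aff = D₊(Z)`, `inf = D₊(Y)` of
  `WeierstrassSchemeCharts`, in the hypersurface presentation of `WeierstrassCurveCharts`), and
  `W.squareChart a b : specOver K (A_a ⊗ A_b) ⟶ E ⊗ E`, `Spec (A_a ⊗_K A_b) = U_a ×_K U_b → E ×_K E`,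
  an open immersion (`pullbackSpecIso` and `pullback.map` of the two charts) with image
  `fst⁻¹(U_a) ∩ snd⁻¹(U_b)` (`range_squareChart_left`); the four of them cover `E ×_K E`
  (`exists_mem_range_squareChart`); `A_a ⊗ A_b` is a domain (`isDomain_squareRing`);
* the **tautological pair** `W.tautFst a b`, `W.tautSnd a b ∈ (A_a ⊗ A_b)³` (the two tautological
  vectors pushed along `includeLeft`, `includeRight`), solutions of the Weierstrass equation with a
  coordinate equal to `1`.

This is the set-up of Silverman, *AEC*, III.3.6 (the addition morphism is constructed on `E × E`
chart by chart) in scheme-theoretic form.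

## References

* [SilvermanAEC2009] J. H. Silverman, *AEC*, 2nd ed.: III.3.6.
* [Hartshorne1977] R. Hartshorne, *Algebraic Geometry*: II Thm. 3.3 (fibre products, affine case).
* The Stacks project, Tag 038F (products of varieties). [StacksProject]

## Design notes

Dot-notation extensions of Mathlib's `WeierstrassCurve`; `K : Type u`; the chart indices `a b : ChartIdx`
(`WeierstrassSchemeCharts`), the inverted coordinate of the chart `a` being `a.i : Fin 3`.
-/

noncomputable section

open CategoryTheory CategoryTheory.Limits AlgebraicGeometry MvPolynomial MonoidalCategory
  CartesianMonoidalCategory TensorProduct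
open Literature.AlgebraicGeometry.Motives Literature.AlgebraicGeometry.Motives.SmoothHypersurface
open Literature.NumberTheory.EllipticCurves.WeierstrassScheme (ChartIdx)
open scoped WeierstrassCurve.Projective

universe u

namespace WeierstrassCurve

variable {K : Type u} [Field K] (W : WeierstrassCurve K)

/-! ### Integrality of `Y ×_K E` -/

/-- `E_W` is locally Noetherian (of finite type over a field). [folklore] -/
instance isLocallyNoetherian_scheme_left : IsLocallyNoetherian W.scheme.left :=
  LocallyOfFiniteType.isLocallyNoetherian W.scheme.hom

/-- **`Y ×_K E_W` is integral for `Y` integral and locally Noetherian** (`W` elliptic): `E_W → Spec K`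
is geometrically integral, flat and universally open (smooth). Mathlib's instance for
`pullback f g`; Stacks 038F. [cite: StacksProject, Tag 038F] -/
instance isIntegral_tensor_left [W.IsElliptic] (Y : SchemeOver K) [AlgebraicGeometry.IsIntegral Y.left]
    [IsLocallyNoetherian Y.left] : AlgebraicGeometry.IsIntegral (Y ⊗ W.scheme).left :=
  inferInstanceAs (AlgebraicGeometry.IsIntegral (pullback Y.hom W.scheme.hom))

/-- `Y ×_K E_W` is locally Noetherian for `Y` locally Noetherian. [folklore] -/
instance isLocallyNoetherian_tensor_left (Y : SchemeOver K) [IsLocallyNoetherian Y.left] :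
    IsLocallyNoetherian (Y ⊗ W.scheme).left :=
  inferInstanceAs (IsLocallyNoetherian (pullback Y.hom W.scheme.hom))

/-- **`E_W ×_K E_W` is integral** (`W` elliptic). [cite: StacksProject, Tag 038F] -/
instance isIntegral_square_left [W.IsElliptic] : AlgebraicGeometry.IsIntegral (W.scheme ⊗ W.scheme).left :=
  W.isIntegral_tensor_left W.scheme

/-- **`(E_W ×_K E_W) ×_K E_W` is integral** (`W` elliptic). [cite: StacksProject, Tag 038F] -/
instance isIntegral_cube_left [W.IsElliptic] :
    AlgebraicGeometry.IsIntegral ((W.scheme ⊗ W.scheme) ⊗ W.scheme).left :=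
  W.isIntegral_tensor_left (W.scheme ⊗ W.scheme)

/-! ### The affine charts `Spec (A_a ⊗_K A_b)` of `E ×_K E` -/

/-- **The coordinate ring `A_a ⊗_K A_b` of the chart `U_a ×_K U_b` of `E ×_K E`** (`a b : ChartIdx`). [folklore] -/
abbrev squareRing (a b : ChartIdx) : Type u :=
  W.chartRing a.i ⊗[K] W.chartRing b.i

/-- `pullback.map` of the two charts: `Spec A_a ×_K Spec A_b → E ×_K E`. [folklore] -/
abbrev chartsPullbackMap (a b : ChartIdx) :
    pullback (Spec.map (CommRingCat.ofHom (algebraMap K (W.chartRing a.i))))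
        (Spec.map (CommRingCat.ofHom (algebraMap K (W.chartRing b.i)))) ⟶
      pullback W.scheme.hom W.scheme.hom :=
  pullback.map _ _ _ _ (W.chartLeft a.i) (W.chartLeft b.i) (𝟙 _)
    ((Category.comp_id _).trans (W.chartLeft_comp_hom a.i).symm)
    ((Category.comp_id _).trans (W.chartLeft_comp_hom b.i).symm)

/-- `pullback.map` of two open immersions is an open immersion (Mathlib
`MorphismProperty.pullbackMap`). [folklore] -/
instance isOpenImmersion_chartsPullbackMap (a b : ChartIdx) : IsOpenImmersion (W.chartsPullbackMap a b) :=
  MorphismProperty.pullbackMap (P := @IsOpenImmersion) inferInstance inferInstance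
    (W.chartLeft_comp_hom a.i).symm (W.chartLeft_comp_hom b.i).symm

/-- **The chart `Spec (A_a ⊗_K A_b) = Spec A_a ×_K Spec A_b → E ×_K E`**, as a morphism of schemes
(Mathlib `pullbackSpecIso` followed by `pullback.map` of the two charts). [folklore] -/
def squareChartLeft (a b : ChartIdx) : Spec (.of (W.squareRing a b)) ⟶ pullback W.scheme.hom W.scheme.hom :=
  (pullbackSpecIso K (W.chartRing a.i) (W.chartRing b.i)).inv ≫ W.chartsPullbackMap a b

/-- `Spec (A_a ⊗ A_b) → E ×_K E` is an open immersion. [folklore] -/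
instance isOpenImmersion_squareChartLeft (a b : ChartIdx) : IsOpenImmersion (W.squareChartLeft a b) := by
  unfold squareChartLeft
  infer_instance

/-- `squareChartLeft ≫ fst = Spec (includeLeft) ≫ chart_a`. [folklore] -/
@[reassoc]
theorem squareChartLeft_fst (a b : ChartIdx) :
    W.squareChartLeft a b ≫ pullback.fst _ _ =
      Spec.map (CommRingCat.ofHom Algebra.TensorProduct.includeLeftRingHom) ≫ W.chartLeft a.i := by
  rw [squareChartLeft, Category.assoc, pullback.lift_fst, pullbackSpecIso_inv_fst_assoc]

/-- `squareChartLeft ≫ snd = Spec (includeRight) ≫ chart_b`. [folklore] -/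
@[reassoc]
theorem squareChartLeft_snd (a b : ChartIdx) :
    W.squareChartLeft a b ≫ pullback.snd _ _ =
      Spec.map (CommRingCat.ofHom (Algebra.TensorProduct.includeRight (R := K)
        (A := W.chartRing a.i) (B := W.chartRing b.i)).toRingHom) ≫
        W.chartLeft b.i := by
  rw [squareChartLeft, Category.assoc, pullback.lift_snd, pullbackSpecIso_inv_snd_assoc]
  rfl

/-- **The image of `Spec (A_a ⊗ A_b) → E ×_K E` is `fst⁻¹(U_a) ∩ snd⁻¹(U_b)`.** [folklore] -/
theorem range_squareChartLeft (a b : ChartIdx) :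
    Set.range (W.squareChartLeft a b) =
      pullback.fst W.scheme.hom W.scheme.hom ⁻¹' Set.range (W.chartLeft a.i) ∩
        pullback.snd W.scheme.hom W.scheme.hom ⁻¹' Set.range (W.chartLeft b.i) := by
  have hs : Function.Surjective (pullbackSpecIso K (W.chartRing a.i)
      (W.chartRing b.i)).inv :=
    (pullbackSpecIso K _ _).inv.homeomorph.surjective
  rw [squareChartLeft, Scheme.Hom.comp_base, TopCat.coe_comp, Set.range_comp,
    Set.range_eq_univ.mpr hs, Set.image_univ]
  exact Scheme.Pullback.range_map _ _ W.scheme.hom W.scheme.hom (W.chartLeft a.i)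
    (W.chartLeft b.i) (𝟙 _) _ _

/-- **The chart `Spec (A_a ⊗_K A_b) → E ⊗ E` in `Over (Spec K)`.** [folklore] -/
def squareChart (a b : ChartIdx) : specOver K (W.squareRing a b) ⟶ W.scheme ⊗ W.scheme :=
  Over.homMk (W.squareChartLeft a b) (by
    change W.squareChartLeft a b ≫ pullback.fst W.scheme.hom W.scheme.hom ≫ W.scheme.hom =
      Spec.map (CommRingCat.ofHom (algebraMap K (W.squareRing a b)))
    rw [W.squareChartLeft_fst_assoc, chartLeft_comp_hom, ← Spec.map_comp, ← CommRingCat.ofHom_comp])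

/-- The underlying morphism of `squareChart` (`rfl`). [folklore] -/
@[simp]
theorem squareChart_left (a b : ChartIdx) : (W.squareChart a b).left = W.squareChartLeft a b := rfl

/-- `Spec (A_a ⊗ A_b) → E ⊗ E` is an open immersion. [folklore] -/
instance isOpenImmersion_squareChart_left (a b : ChartIdx) : IsOpenImmersion (W.squareChart a b).left :=
  inferInstanceAs (IsOpenImmersion (W.squareChartLeft a b))

/-- The first projection of the chart is `Spec (includeLeft) ≫ chart_a` over `K`. [folklore] -/
theorem squareChart_fst (a b : ChartIdx) :
    W.squareChart a b ≫ fst _ _ =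
      specOverOfAlgHom (Algebra.TensorProduct.includeLeft : W.chartRing a.i →ₐ[K] _) ≫
        W.chart a.i := by
  ext : 1
  exact W.squareChartLeft_fst a b

/-- The second projection of the chart is `Spec (includeRight) ≫ chart_b` over `K`. [folklore] -/
theorem squareChart_snd (a b : ChartIdx) :
    W.squareChart a b ≫ snd _ _ =
      specOverOfAlgHom (Algebra.TensorProduct.includeRight : W.chartRing b.i →ₐ[K] _) ≫
        W.chart b.i := by
  ext : 1
  exact W.squareChartLeft_snd a b

/-- **The four charts `Spec (A_a ⊗ A_b)` cover `E ×_K E`.** [folklore] -/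
theorem exists_mem_range_squareChart (x : (W.scheme ⊗ W.scheme).left) :
    ∃ a b : ChartIdx, x ∈ Set.range (W.squareChart a b).left := by
  obtain ⟨a, ha⟩ := W.exists_mem_chart_range (pullback.fst W.scheme.hom W.scheme.hom x)
  obtain ⟨b, hb⟩ := W.exists_mem_chart_range (pullback.snd W.scheme.hom W.scheme.hom x)
  refine ⟨a, b, ?_⟩
  change x ∈ Set.range (W.squareChartLeft a b)
  rw [range_squareChartLeft]
  exact ⟨ha, hb⟩

/-! ### `A_a ⊗_K A_b` is a domain -/

/-- A `K̄`-point of the chart `U_a`: `(0, y₀, 1)` with `y₀² + a₃ y₀ = a₆` on `aff = D₊(Z)` and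
`O = (0, 1, 0)` on `inf = D₊(Y)`; as a `K`-algebra map `A_a → K̄` (`liftVec`). [cite: SilvermanAEC2009, III.1] -/
theorem exists_algHom_chartRing_algebraicClosure (a : ChartIdx) :
    Nonempty (W.chartRing a.i →ₐ[K] AlgebraicClosure K) := by
  let L := AlgebraicClosure K
  cases a
  case inf =>
    refine ⟨liftVec (n := 1) W.toProjective.polynomial 1 W.toProjective.isHomogeneous_polynomial
      (S := L) ![0, 1, 0] (by simp) ?_⟩
    rw [aeval_toProjective_polynomial_ring]
    exact Projective.equation_zero
  case aff =>
    obtain ⟨y₀, hy₀⟩ : ∃ y₀ : L, y₀ ^ 2 + algebraMap K L W.a₃ * y₀ - algebraMap K L W.a₆ = 0 := by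
      have hdeg : (Polynomial.X ^ 2 + Polynomial.C (algebraMap K L W.a₃) * Polynomial.X
          - Polynomial.C (algebraMap K L W.a₆)).degree ≠ 0 := by
        rw [sub_eq_add_neg, ← Polynomial.C_neg, show (Polynomial.X : Polynomial L) ^ 2 =
          Polynomial.C 1 * Polynomial.X ^ 2 by rw [map_one, one_mul], Polynomial.degree_quadratic one_ne_zero]
        decide
      obtain ⟨y₀, hy₀⟩ := IsAlgClosed.exists_root _ hdeg
      exact ⟨y₀, by simpa using hy₀⟩
    refine ⟨liftVec (n := 1) W.toProjective.polynomial 2 W.toProjective.isHomogeneous_polynomial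
      (S := L) ![0, y₀, 1] (by simp) ?_⟩
    rw [aeval_toProjective_polynomial_ring, ← Projective.Equation, Projective.equation_some,
      Affine.equation_iff]
    have hy₀' : y₀ ^ 2 + (W.baseChange L).toProjective.toAffine.a₃ * y₀ -
        (W.baseChange L).toProjective.toAffine.a₆ = 0 := hy₀
    simp only [mul_zero, add_zero, zero_pow three_ne_zero, zero_add]
    linear_combination hy₀'

/-- `A_a ⊗_K A_b` is non-trivial (it maps to `K̄`). [folklore] -/
instance nontrivial_squareRing (a b : ChartIdx) : Nontrivial (W.squareRing a b) := by
  obtain ⟨f⟩ := W.exists_algHom_chartRing_algebraicClosure a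
  obtain ⟨g⟩ := W.exists_algHom_chartRing_algebraicClosure b
  exact (Algebra.TensorProduct.productMap f g).toRingHom.domain_nontrivial

/-- **`A_a ⊗_K A_b` is a domain** (`W` elliptic): `Spec (A_a ⊗ A_b)` is a non-empty open subscheme of
the integral scheme `E ×_K E`. [cite: StacksProject, Tag 038F] -/
instance isDomain_squareRing [W.IsElliptic] (a b : ChartIdx) : IsDomain (W.squareRing a b) := by
  haveI : Nonempty (specOver K (W.squareRing a b)).left :=
    inferInstanceAs (Nonempty (PrimeSpectrum (W.squareRing a b)))
  haveI : AlgebraicGeometry.IsIntegral (specOver K (W.squareRing a b)).left :=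
    isIntegral_of_isOpenImmersion (W.squareChart a b).left
  exact (affine_isIntegral_iff (CommRingCat.of (W.squareRing a b))).mp
    (inferInstanceAs (AlgebraicGeometry.IsIntegral (specOver K (W.squareRing a b)).left))

/-! ### The tautological pair -/

/-- **The first tautological vector** on `U_a ×_K U_b`: `tautVec a ⊗ 1 ∈ (A_a ⊗ A_b)³`. [folklore] -/
def tautFst (a b : ChartIdx) : Fin 3 → W.squareRing a b :=
  fun j => Algebra.TensorProduct.includeLeft (S := K) (W.tautVec a.i j)

/-- **The second tautological vector** on `U_a ×_K U_b`: `1 ⊗ tautVec b ∈ (A_a ⊗ A_b)³`. [folklore] -/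
def tautSnd (a b : ChartIdx) : Fin 3 → W.squareRing a b :=
  fun j => (Algebra.TensorProduct.includeRight : W.chartRing b.i →ₐ[K] _)
    (W.tautVec b.i j)

/-- Unfolding `tautFst` (`rfl`). [folklore] -/
theorem tautFst_apply (a b : ChartIdx) (j : Fin 3) :
    W.tautFst a b j = Algebra.TensorProduct.includeLeft (S := K) (W.tautVec a.i j) := rfl

/-- Unfolding `tautSnd` (`rfl`). [folklore] -/
theorem tautSnd_apply (a b : ChartIdx) (j : Fin 3) :
    W.tautSnd a b j = (Algebra.TensorProduct.includeRight : W.chartRing b.i →ₐ[K] _)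
      (W.tautVec b.i j) := rfl

/-- The `a`-coordinate of the first tautological vector is `1`. [folklore] -/
@[simp]
theorem tautFst_self (a b : ChartIdx) : W.tautFst a b a.i = 1 := by
  rw [tautFst_apply, tautVec_self, map_one]

/-- The `b`-coordinate of the second tautological vector is `1`. [folklore] -/
@[simp]
theorem tautSnd_self (a b : ChartIdx) : W.tautSnd a b b.i = 1 := by
  rw [tautSnd_apply, tautVec_self, map_one]

/-- Solutions of the homogeneous Weierstrass equation map to solutions under `K`-algebra maps.
[folklore] -/
theorem equation_comp_algHom {S T : Type u} [CommRing S] [Algebra K S] [CommRing T] [Algebra K T]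
    (φ : S →ₐ[K] T) {v : Fin 3 → S} (hv : (W.baseChange S).toProjective.Equation v) :
    (W.baseChange T).toProjective.Equation (fun j => φ (v j)) := by
  have h := Projective.Equation.map φ.toRingHom hv
  rw [show ((W.baseChange S).toProjective).map φ.toRingHom = (W.baseChange T).toProjective by
    change (W.map (algebraMap K S)).map φ.toRingHom = W.map (algebraMap K T)
    rw [map_map, AlgHom.toRingHom_eq_coe, AlgHom.comp_algebraMap]] at h
  exact h

/-- **The first tautological vector solves the Weierstrass equation.** [folklore] -/
theorem equation_tautFst (a b : ChartIdx) :
    (W.baseChange (W.squareRing a b)).toProjective.Equation (W.tautFst a b) :=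
  W.equation_comp_algHom _ (W.equation_tautVec a.i)

/-- **The second tautological vector solves the Weierstrass equation.** [folklore] -/
theorem equation_tautSnd (a b : ChartIdx) :
    (W.baseChange (W.squareRing a b)).toProjective.Equation (W.tautSnd a b) :=
  W.equation_comp_algHom _ (W.equation_tautVec b.i)

end WeierstrassCurve
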